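import Summits.AtomisticToContinuum.FouriersLaw.Theorems.VanishingNoiseTransferNoiseLocalityStubResponseDensityNoisyAux7
import Summits.AtomisticToContinuum.FouriersLaw.Theorems.OddSectorIrreversibilityOddDensityIsCorrectorMainPrep2
import Summits.AtomisticToContinuum.FouriersLaw.Theorems.OddSectorIrreversibilityCorrectorTheoryBondSum

/-!
# Duhamel flip bound, part 3: the McLennan potential as a flip-invariant weak pair, and
Cauchy–Schwarz in the flip Dirichlet form (helpers for stub `stub_duhamelFlipBound`)

Helper file `--supports stmt-AtomisticToContinuum-11975` (crux `NoiseLocality`, route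
`VanishingNoiseTransfer`, line `relative-flip-energy-transfer`, stub 2 `stub_duhamelFlipBound`).

Two groups of `L²(μ_T)` facts for the pinned chain (`μ_T = gibbsMeasure N T`, `Θ_i = momentumFlip i`,
`S f = ∑_i (f∘Θ_i - f)` the velocity-flip generator, `Θ(q,p) = (q,-p)`):

* the McLennan potential `Ψ = X/((N-1)T²) - H/(2T²)` (`X = energyMoment`, `LΨ = J/((N-1)T²) + φ`,
  `φ = γ(p_0² - p_{N-1}²)/(2T²)`, `pinnedChain_generator_mclennanPotential`) is invariant under every
  single flip (`energyMoment_momentumFlip`, `flipNoise_mclennanPotential`: `S Ψ = 0`), lies in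
  `L²(μ_T)` together with `LΨ`, `φ` and `J = ∑_i j_i` (`memLp_mclennanPotential`,
  `memLp_generator_mclennanPotential`, `memLp_mclennanSource`, `memLp_totalCurrent`), and `(Ψ, LΨ)` is
  a weak solution pair in the sense of part 2 (`weakPair_mclennanPotential`: integration by parts
  against test functions, `L† = ΘLΘ`);
* the flip form: polarisation `∫ a (S b) dμ = -½ ∑_i ∫ (a∘Θ_i - a)(b∘Θ_i - b) dμ` for a flip-invariant
  `μ` and `a, b ∈ L²(μ)` (`integral_mul_flipNoise_eq`), the Cauchy–Schwarz bound
  `|∫ a (S b) dμ| ≤ √(½∑_i∫(b - b∘Θ_i)²) √(½∑_i∫(a - a∘Θ_i)²)` (`abs_integral_mul_flipNoise_le`), and the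
  invariance of the flip energy under `Θ` (`flipEnergy_comp_reversal`, since `Θ∘Θ_i = Θ_i∘Θ`, for any
  `Θ`-invariant measure).

No definitions.
-/

noncomputable section

open MeasureTheory Filter Topology
open scoped ContDiff

namespace Summit.AtomisticToContinuum.FouriersLaw.Theorems.NoiseLocality.StubDuhamelFlipBound

open Literature.MathematicalPhysics.KineticTheory.HeatConduction
open Summit.AtomisticToContinuum.FouriersLaw.Theorems.OddSectorIrreversibility
open Summit.AtomisticToContinuum.FouriersLaw.Theorems.NoiseLocality.StubResponseDensityNoisy
open Literature.Barriers.AtomisticToContinuum.OpenChain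

variable {N : ℕ}

/-! ### The McLennan potential is flip-invariant -/

/-- The energy first moment `X` only sees `p_i²`, so it is invariant under each single flip `Θ_i`. -/
theorem energyMoment_momentumFlip (P : OscillatorChain) (i : Fin N) (x : PhaseSpace N) :
    energyMoment P N (momentumFlip i x) = energyMoment P N x := by
  unfold energyMoment
  simp only [momentumFlip_fst]
  congr 1
  refine Finset.sum_congr rfl fun k _ => ?_
  by_cases h : k = i
  · subst h
    rw [momentumFlip_snd_self]
    ring
  · rw [momentumFlip_snd_of_ne h]

/-- `S (a X + b H) = 0` pointwise: the McLennan potential is annihilated by the flip generator. -/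
theorem flipNoise_mclennanPotential (P : OscillatorChain) (a b : ℝ) (x : PhaseSpace N) :
    flipNoise N (fun y => a * energyMoment P N y + b * P.hamiltonian N y) x = 0 := by
  simp [flipNoise_eq, energyMoment_momentumFlip, OscillatorChain.hamiltonian_momentumFlip]

/-! ### `L²(μ_T)` membership of the McLennan data -/

/-- `2 · (1/(4T)) < 1/T` for `T > 0`. -/
theorem two_mul_quarter_lt {T : ℝ} (hT : 0 < T) : 2 * (1 / (4 * T)) < 1 / T := by
  rw [show (2 : ℝ) * (1 / (4 * T)) = 1 / (2 * T) by field_simp; ring]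
  exact one_div_lt_one_div_of_lt hT (by linarith)

section Pinned

variable {ω₂ lam β γ : ℝ} (hω : 0 < ω₂) (hl : 0 ≤ lam) (hβ : 0 < β) {T : ℝ} (hT : 0 < T)
include hω hl hβ hT

/-- The McLennan potential `Ψ = X/((N-1)T²) - H/(2T²)` is in `L²(μ_T)`. -/
theorem memLp_mclennanPotential (N : ℕ) :
    MemLp (fun y => (((N : ℝ) - 1) * T ^ 2)⁻¹ * energyMoment (pinnedChain ω₂ lam β γ) N y +
        (-(2 * T ^ 2)⁻¹) * (pinnedChain ω₂ lam β γ).hamiltonian N y) 2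
      ((pinnedChain ω₂ lam β γ).gibbsMeasure N T) := by
  have hU : ContDiff ℝ ∞ (pinnedChain ω₂ lam β γ).U := pinnedChain_contDiff_U ω₂ lam β γ
  have hV : ContDiff ℝ ∞ (pinnedChain ω₂ lam β γ).V := pinnedChain_contDiff_V ω₂ lam β γ
  have hc : Continuous fun y => (((N : ℝ) - 1) * T ^ 2)⁻¹ * energyMoment (pinnedChain ω₂ lam β γ) N y +
      (-(2 * T ^ 2)⁻¹) * (pinnedChain ω₂ lam β γ).hamiltonian N y :=
    ((contDiff_const.mul (contDiff_energyMoment _ hU hV N)).add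
      (contDiff_const.mul ((pinnedChain ω₂ lam β γ).contDiff_hamiltonian hU hV N))).continuous
  have hϑ0 : 0 < 1 / (4 * T) := by positivity
  exact Corrector.memLp_two_of_abs_le_exp hω hl hβ.le hT γ hc (two_mul_quarter_lt hT)
    (pinnedChain_abs_mclennanPotential_le hω hl hβ hϑ0)

/-- `LΨ` is in `L²(μ_T)` (`N ≥ 2`). -/
theorem memLp_generator_mclennanPotential (hN : 2 ≤ N) :
    MemLp ((pinnedChain ω₂ lam β γ).generator N T T (fun y =>
        (((N : ℝ) - 1) * T ^ 2)⁻¹ * energyMoment (pinnedChain ω₂ lam β γ) N y +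
          (-(2 * T ^ 2)⁻¹) * (pinnedChain ω₂ lam β γ).hamiltonian N y)) 2
      ((pinnedChain ω₂ lam β γ).gibbsMeasure N T) := by
  have hU : ContDiff ℝ ∞ (pinnedChain ω₂ lam β γ).U := pinnedChain_contDiff_U ω₂ lam β γ
  have hV : ContDiff ℝ ∞ (pinnedChain ω₂ lam β γ).V := pinnedChain_contDiff_V ω₂ lam β γ
  have hΨ2 : ContDiff ℝ 2 (fun y => (((N : ℝ) - 1) * T ^ 2)⁻¹ * energyMoment (pinnedChain ω₂ lam β γ) N y +
      (-(2 * T ^ 2)⁻¹) * (pinnedChain ω₂ lam β γ).hamiltonian N y) :=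
    ((contDiff_const.mul (contDiff_energyMoment _ hU hV N)).add
      (contDiff_const.mul ((pinnedChain ω₂ lam β γ).contDiff_hamiltonian hU hV N))).of_le (by norm_cast)
  have hc := (pinnedChain ω₂ lam β γ).continuous_generator (pinnedChain_contDiff_U ω₂ lam β γ)
    (pinnedChain_contDiff_V ω₂ lam β γ) N T T hΨ2
  have hϑ0 : 0 < 1 / (4 * T) := by positivity
  exact Corrector.memLp_two_of_abs_le_exp hω hl hβ.le hT γ hc (two_mul_quarter_lt hT)
    (pinnedChain_abs_generator_mclennanPotential_le hω hl hβ hN hT.ne' hϑ0)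

/-- The McLennan source `φ = γ(p_a² - p_b²)/(2T²)` is in `L²(μ_T)` (any two sites `a, b`). -/
theorem memLp_mclennanSource (a b : Fin N) :
    MemLp (fun x : PhaseSpace N => γ / (2 * T ^ 2) * (x.2 a ^ 2 - x.2 b ^ 2)) 2
      ((pinnedChain ω₂ lam β γ).gibbsMeasure N T) := by
  have hc : Continuous fun x : PhaseSpace N => γ / (2 * T ^ 2) * (x.2 a ^ 2 - x.2 b ^ 2) := by fun_prop
  have hϑ0 : 0 < 1 / (4 * T) := by positivity
  exact Corrector.memLp_two_of_abs_le_exp hω hl hβ.le hT γ hc (two_mul_quarter_lt hT)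
    (pinnedChain_abs_mclennanSource_le hω hl hβ.le N hϑ0 a b)

/-- The total current `J = ∑_i j_i` is in `L²(μ_T)`. -/
theorem memLp_totalCurrent (N : ℕ) :
    MemLp (fun x => ∑ i : Fin N, (pinnedChain ω₂ lam β γ).bondCurrent N i x) 2
      ((pinnedChain ω₂ lam β γ).gibbsMeasure N T) :=
  memLp_finsetSum _ fun i _ => memLp_bondCurrent_gibbsMeasure hω hl hβ.le γ N hT i

end Pinned

/-- **`(Ψ, LΨ)` is a weak solution pair** (part 2's hypothesis): for every test function `g`,
`∫ (L g) · (Ψ∘Θ) dμ_T = ∫ g · (LΨ)∘Θ dμ_T` — integration by parts against the compactly supported `g`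
(`L† = ΘLΘ`, `pinnedChain_integral_generator_mul_gibbsMeasure_eq_reversal` with `k = Ψ∘Θ ∈ C²`). -/
theorem weakPair_mclennanPotential (ω₂ lam β γ : ℝ) (N : ℕ) {T : ℝ} (hT : T ≠ 0)
    {g : PhaseSpace N → ℝ} (hg : ContDiff ℝ ∞ g) (hgc : HasCompactSupport g) :
    ∫ x, (pinnedChain ω₂ lam β γ).generator N T T g x *
        (fun y => (((N : ℝ) - 1) * T ^ 2)⁻¹ * energyMoment (pinnedChain ω₂ lam β γ) N y +
          (-(2 * T ^ 2)⁻¹) * (pinnedChain ω₂ lam β γ).hamiltonian N y) (x.1, -x.2)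
        ∂((pinnedChain ω₂ lam β γ).gibbsMeasure N T) =
      ∫ x, g x * (pinnedChain ω₂ lam β γ).generator N T T (fun y =>
        (((N : ℝ) - 1) * T ^ 2)⁻¹ * energyMoment (pinnedChain ω₂ lam β γ) N y +
          (-(2 * T ^ 2)⁻¹) * (pinnedChain ω₂ lam β γ).hamiltonian N y) (x.1, -x.2)
        ∂((pinnedChain ω₂ lam β γ).gibbsMeasure N T) := by
  set P := pinnedChain ω₂ lam β γ with hP
  set Ψ : PhaseSpace N → ℝ := fun y => (((N : ℝ) - 1) * T ^ 2)⁻¹ * energyMoment P N y +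
    (-(2 * T ^ 2)⁻¹) * P.hamiltonian N y with hΨ
  have hU : ContDiff ℝ ∞ P.U := pinnedChain_contDiff_U ω₂ lam β γ
  have hV : ContDiff ℝ ∞ P.V := pinnedChain_contDiff_V ω₂ lam β γ
  have hΨinf : ContDiff ℝ ∞ Ψ := (contDiff_const.mul (contDiff_energyMoment P hU hV N)).add
    (contDiff_const.mul (P.contDiff_hamiltonian hU hV N))
  have hk2 : ContDiff ℝ 2 (fun y : PhaseSpace N => Ψ (y.1, -y.2)) :=
    (hΨinf.comp (contDiff_fst.prodMk contDiff_snd.neg)).of_le (by norm_cast)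
  have h := pinnedChain_integral_generator_mul_gibbsMeasure_eq_reversal ω₂ lam β γ N hT
    (hg.of_le (by norm_cast)) hgc hk2
  have ek : (fun y : PhaseSpace N => (fun y : PhaseSpace N => Ψ (y.1, -y.2)) (y.1, -y.2)) = Ψ := by
    funext y; simp
  rw [ek] at h
  exact h

/-! ### The flip Dirichlet form: polarisation, Cauchy–Schwarz, `Θ`-invariance -/

/-- **Polarisation of the flip form**: for a flip-invariant measure `μ` and `a, b ∈ L²(μ)`,
`∫ a · (S b) dμ = -½ ∑_i ∫ (a∘Θ_i - a)(b∘Θ_i - b) dμ`. -/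
theorem integral_mul_flipNoise_eq {μ : Measure (PhaseSpace N)}
    (hμ : ∀ i, MeasurePreserving (momentumFlip i) μ μ) {a b : PhaseSpace N → ℝ}
    (ha : MemLp a 2 μ) (hb : MemLp b 2 μ) :
    ∫ x, a x * flipNoise N b x ∂μ =
      -(1 / 2) * ∑ i : Fin N, ∫ x, (a (momentumFlip i x) - a x) * (b (momentumFlip i x) - b x) ∂μ := by
  have haΘ : ∀ i : Fin N, MemLp (fun x => a (momentumFlip i x)) 2 μ := fun i =>
    ha.comp_measurePreserving (hμ i)
  have hbΘ : ∀ i : Fin N, MemLp (fun x => b (momentumFlip i x)) 2 μ := fun i =>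
    hb.comp_measurePreserving (hμ i)
  have hterm : ∀ i : Fin N, ∫ x, a x * (b (momentumFlip i x) - b x) ∂μ =
      -(1 / 2) * ∫ x, (a (momentumFlip i x) - a x) * (b (momentumFlip i x) - b x) ∂μ := by
    intro i
    have i1 : Integrable (fun x => a (momentumFlip i x) * b (momentumFlip i x)) μ :=
      (haΘ i).integrable_mul (hbΘ i)
    have i2 : Integrable (fun x => a (momentumFlip i x) * b x) μ := (haΘ i).integrable_mul hb
    have i3 : Integrable (fun x => a x * b (momentumFlip i x)) μ := ha.integrable_mul (hbΘ i)
    have i4 : Integrable (fun x => a x * b x) μ := ha.integrable_mul hb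
    have e1 : ∫ x, a (momentumFlip i x) * b (momentumFlip i x) ∂μ = ∫ x, a x * b x ∂μ :=
      integral_comp_momentumFlip (hμ i) (fun x => a x * b x)
    have e2 : ∫ x, a (momentumFlip i x) * b x ∂μ = ∫ x, a x * b (momentumFlip i x) ∂μ :=
      (integral_mul_comp_momentumFlip (hμ i) b a).symm
    have eL : ∫ x, a x * (b (momentumFlip i x) - b x) ∂μ =
        (∫ x, a x * b (momentumFlip i x) ∂μ) - ∫ x, a x * b x ∂μ := by
      rw [← integral_sub i3 i4]
      exact integral_congr_ae (Eventually.of_forall fun x => by ring)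
    have i12 : Integrable (fun x => a (momentumFlip i x) * b (momentumFlip i x) -
        a (momentumFlip i x) * b x) μ := i1.sub i2
    have i123 : Integrable (fun x => a (momentumFlip i x) * b (momentumFlip i x) -
        a (momentumFlip i x) * b x - a x * b (momentumFlip i x)) μ := i12.sub i3
    have eR : ∫ x, (a (momentumFlip i x) - a x) * (b (momentumFlip i x) - b x) ∂μ =
        (∫ x, a (momentumFlip i x) * b (momentumFlip i x) ∂μ) - (∫ x, a (momentumFlip i x) * b x ∂μ) -
          (∫ x, a x * b (momentumFlip i x) ∂μ) + ∫ x, a x * b x ∂μ := by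
      rw [← integral_sub i1 i2, ← integral_sub i12 i3, ← integral_add i123 i4]
      exact integral_congr_ae (Eventually.of_forall fun x => by ring)
    rw [eL, eR, e1, e2]
    ring
  calc ∫ x, a x * flipNoise N b x ∂μ
      = ∫ x, ∑ i : Fin N, a x * (b (momentumFlip i x) - b x) ∂μ :=
        integral_congr_ae (Eventually.of_forall fun x => by simp only [flipNoise_eq, Finset.mul_sum])
    _ = ∑ i : Fin N, ∫ x, a x * (b (momentumFlip i x) - b x) ∂μ :=
        integral_finsetSum _ fun i _ => ha.integrable_mul ((hbΘ i).sub hb)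
    _ = ∑ i : Fin N, (-(1 / 2) * ∫ x, (a (momentumFlip i x) - a x) * (b (momentumFlip i x) - b x) ∂μ) :=
        Finset.sum_congr rfl fun i _ => hterm i
    _ = _ := by rw [Finset.mul_sum]

/-- **Cauchy–Schwarz in the flip form**: for a flip-invariant `μ` and `a, b ∈ L²(μ)`,
`|∫ a · (S b) dμ| ≤ √(½ ∑_i ∫ (b - b∘Θ_i)² dμ) · √(½ ∑_i ∫ (a - a∘Θ_i)² dμ)`. -/
theorem abs_integral_mul_flipNoise_le {μ : Measure (PhaseSpace N)}
    (hμ : ∀ i, MeasurePreserving (momentumFlip i) μ μ) {a b : PhaseSpace N → ℝ}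
    (ha : MemLp a 2 μ) (hb : MemLp b 2 μ) :
    |∫ x, a x * flipNoise N b x ∂μ| ≤
      Real.sqrt ((1 / 2) * ∑ i : Fin N, ∫ x, (b x - b (momentumFlip i x)) ^ 2 ∂μ) *
        Real.sqrt ((1 / 2) * ∑ i : Fin N, ∫ x, (a x - a (momentumFlip i x)) ^ 2 ∂μ) := by
  have haΘ : ∀ i : Fin N, MemLp (fun x => a (momentumFlip i x)) 2 μ := fun i =>
    ha.comp_measurePreserving (hμ i)
  have hbΘ : ∀ i : Fin N, MemLp (fun x => b (momentumFlip i x)) 2 μ := fun i =>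
    hb.comp_measurePreserving (hμ i)
  set A : Fin N → ℝ := fun i => ∫ x, (a x - a (momentumFlip i x)) ^ 2 ∂μ with hA
  set B : Fin N → ℝ := fun i => ∫ x, (b x - b (momentumFlip i x)) ^ 2 ∂μ with hB
  have hA0 : ∀ i, 0 ≤ A i := fun i => integral_nonneg fun x => sq_nonneg _
  have hB0 : ∀ i, 0 ≤ B i := fun i => integral_nonneg fun x => sq_nonneg _
  -- termwise Cauchy–Schwarz
  have hcs : ∀ i : Fin N, |∫ x, (a (momentumFlip i x) - a x) * (b (momentumFlip i x) - b x) ∂μ| ≤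
      Real.sqrt (A i) * Real.sqrt (B i) := by
    intro i
    have hda : MemLp (fun x => a (momentumFlip i x) - a x) 2 μ := (haΘ i).sub ha
    have hdb : MemLp (fun x => b (momentumFlip i x) - b x) 2 μ := (hbΘ i).sub hb
    have h := abs_integral_mul_le_sqrt_mul_sqrt μ hda hdb
    have eA : ∫ x, (a (momentumFlip i x) - a x) ^ 2 ∂μ = A i :=
      integral_congr_ae (Eventually.of_forall fun x => by ring)
    have eB : ∫ x, (b (momentumFlip i x) - b x) ^ 2 ∂μ = B i :=
      integral_congr_ae (Eventually.of_forall fun x => by ring)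
    rw [eA, eB] at h
    exact h
  rw [integral_mul_flipNoise_eq hμ ha hb, abs_mul, abs_neg, abs_of_pos (by norm_num : (0 : ℝ) < 1 / 2)]
  calc 1 / 2 * |∑ i : Fin N, ∫ x, (a (momentumFlip i x) - a x) * (b (momentumFlip i x) - b x) ∂μ|
      ≤ 1 / 2 * ∑ i : Fin N, |∫ x, (a (momentumFlip i x) - a x) * (b (momentumFlip i x) - b x) ∂μ| :=
        mul_le_mul_of_nonneg_left (Finset.abs_sum_le_sum_abs _ _) (by norm_num)
    _ ≤ 1 / 2 * ∑ i : Fin N, Real.sqrt (A i) * Real.sqrt (B i) :=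
        mul_le_mul_of_nonneg_left (Finset.sum_le_sum fun i _ => hcs i) (by norm_num)
    _ ≤ 1 / 2 * (Real.sqrt (∑ i : Fin N, A i) * Real.sqrt (∑ i : Fin N, B i)) :=
        mul_le_mul_of_nonneg_left (Real.sum_sqrt_mul_sqrt_le _ hA0 hB0) (by norm_num)
    _ = Real.sqrt ((1 / 2) * ∑ i : Fin N, B i) * Real.sqrt ((1 / 2) * ∑ i : Fin N, A i) := by
        rw [Real.sqrt_mul (by norm_num : (0 : ℝ) ≤ 1 / 2), Real.sqrt_mul (by norm_num : (0 : ℝ) ≤ 1 / 2)]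
        have h2 : Real.sqrt (1 / 2) * Real.sqrt (1 / 2) = 1 / 2 :=
          Real.mul_self_sqrt (by norm_num : (0 : ℝ) ≤ 1 / 2)
        calc 1 / 2 * (Real.sqrt (∑ i : Fin N, A i) * Real.sqrt (∑ i : Fin N, B i))
            = (Real.sqrt (1 / 2) * Real.sqrt (1 / 2)) *
                (Real.sqrt (∑ i : Fin N, A i) * Real.sqrt (∑ i : Fin N, B i)) := by rw [h2]
          _ = _ := by ring

/-- `Θ ∘ Θ_i = Θ_i ∘ Θ` on phase space. -/
theorem reversal_momentumFlip (i : Fin N) (x : PhaseSpace N) :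
    (((momentumFlip i x).1, -(momentumFlip i x).2) : PhaseSpace N) = momentumFlip i (x.1, -x.2) := by
  refine Prod.ext rfl ?_
  show -(momentumFlip i x).2 = (momentumFlip i (x.1, -x.2)).2
  simp only [momentumFlip_apply, neg_update, Pi.neg_apply, neg_neg]

/-- **The flip energy is `Θ`-invariant**: `∑_i ∫ ((U∘Θ) - (U∘Θ)∘Θ_i)² dμ = ∑_i ∫ (U - U∘Θ_i)² dμ`
for every `Θ`-invariant measure `μ` (`Θ` commutes with each `Θ_i`). -/
theorem flipEnergy_comp_reversal {μ : Measure (PhaseSpace N)}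
    (hΘ : MeasurePreserving (momentumReversal N) μ μ) (U : PhaseSpace N → ℝ) :
    ∑ i : Fin N, ∫ x, (U (x.1, -x.2) - U ((momentumFlip i x).1, -(momentumFlip i x).2)) ^ 2 ∂μ =
      ∑ i : Fin N, ∫ x, (U x - U (momentumFlip i x)) ^ 2 ∂μ := by
  refine Finset.sum_congr rfl fun i _ => ?_
  have h : ∫ x, (U (x.1, -x.2) - U (momentumFlip i (x.1, -x.2))) ^ 2 ∂μ =
      ∫ x, (U x - U (momentumFlip i x)) ^ 2 ∂μ :=
    hΘ.integral_comp' (f := momentumReversal N) (fun x => (U x - U (momentumFlip i x)) ^ 2)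
  rw [← h]
  refine integral_congr_ae (Eventually.of_forall fun x => ?_)
  simp only [reversal_momentumFlip]

/-! ### Registered helper sub-goal (stub form, one line) -/

/-- Registered helper sub-goal `helper_duhamelFlipCauchySchwarz` of stub `stub_duhamelFlipBound`
(= `abs_integral_mul_flipNoise_le` in stub form): Cauchy–Schwarz in the flip Dirichlet form. -/
theorem helper_duhamelFlipCauchySchwarz : ∀ (N : ℕ) (μ : MeasureTheory.Measure (Literature.MathematicalPhysics.KineticTheory.HeatConduction.PhaseSpace N)), (∀ i : Fin N, MeasureTheory.MeasurePreserving (Literature.MathematicalPhysics.KineticTheory.HeatConduction.momentumFlip i) μ μ) → ∀ a b : Literature.MathematicalPhysics.KineticTheory.HeatConduction.PhaseSpace N → ℝ, MeasureTheory.MemLp a 2 μ → MeasureTheory.MemLp b 2 μ → |∫ x, a x * Literature.MathematicalPhysics.KineticTheory.HeatConduction.flipNoise N b x ∂μ| ≤ Real.sqrt ((1 / 2) * ∑ i : Fin N, ∫ x, (b x - b (Literature.MathematicalPhysics.KineticTheory.HeatConduction.momentumFlip i x)) ^ 2 ∂μ) * Real.sqrt ((1 / 2) * ∑ i : Fin N,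 ∫ x, (a x - a (Literature.MathematicalPhysics.KineticTheory.HeatConduction.momentumFlip i x)) ^ 2 ∂μ) :=
  fun _ _ hμ _ _ ha hb => abs_integral_mul_flipNoise_le hμ ha hb

end Summit.AtomisticToContinuum.FouriersLaw.Theorems.NoiseLocality.StubDuhamelFlipBound

end
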